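import Summits.Ventures.HodgeRepro2.T5RegularRep
import Mathlib.MeasureTheory.MeasurableSpace.Constructions
import Mathlib.Analysis.Normed.Operator.LinearIsometry

/-!
# T5QuotientPullback — (A3) STEP 1: «L^{K_f} = L²(G(F)\G(𝔸)/K_f)», the pull-back half

Cell pub-hodge-repro2, seat p5, Tier 5 (route/T5-N4-p5.md, N4.3 (A3) STEP 1, l. 147): «For an
open compact `K_f ⊂ G(𝔸_f)`, `L^{K_f} = L²(G(F)\G(𝔸)/K_f)`».  Rows 19 / 21 carry the abstract
`L²` partition of the quotient and row 36 (v2) the `K_f`-invariants `L^{K_f}` inside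
`L²(G(F)\G(𝔸))` under the regular representation; this file makes the identification itself
precise, in the abstract form it has: a group `K` (= `K_f`) acts on a measure space `(X, μ)`
(= `G(F)\G(𝔸)` with its Haar-induced measure), `X/K := MulAction.orbitRel.Quotient K X` carries
the quotient σ-algebra and the push-forward measure `quotMeasure μ = μ.map mk`, and

* `pullback μ : L²(X/K, mk_*μ) →ₗᵢ[ℂ] L²(X, μ)`, `h ↦ h ∘ mk`, is a LINEAR ISOMETRY
  (Mathlib's `Lp.compMeasurePreservingₗᵢ` for the measure-preserving quotient map), with closed
  range (`isClosed_range_pullback`);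
* its range lies in the `K`-invariants `invariants μ = {f ∣ ∀ k, regularRep μ k f = f}` of row 36's
  regular representation (`pullback_mem_invariants`, `range_pullback_le_invariants`): a function
  pulled back from the quotient is `K`-invariant.

The converse inclusion (every `K`-invariant `L²`-class comes from the quotient) is the
DESCENT half, `T5QuotientDescent` (the `K`-average `x ↦ ∫_K f(k x) dk` against a right-invariant
probability measure on `K`); together they give `invariants μ ≃ₗᵢ[ℂ] L²(X/K, mk_*μ)`
(`T5QuotientDescent.invariantsEquiv`).  Nothing about adeles or Haar measures on `G(𝔸)` is
asserted.  Mathlib only besides row 36.  Axioms: propext, Classical.choice, Quot.sound.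
README §8(d): uses an L-value-free non-vanishing device: NO.
-/

namespace Summit.Ventures.HodgeRepro2.T5QuotientPullback

open MeasureTheory
open Summit.Ventures.HodgeRepro2.T5RegularRep

variable {K X : Type*} [Group K] [MulAction K X]

/-! ### The quotient `X/K`, its σ-algebra and its push-forward measure -/

/-- The quotient map `X → X/K` (Mathlib's orbit space `MulAction.orbitRel.Quotient K X`, with
the quotient σ-algebra `Quotient.instMeasurableSpace`). -/
abbrev mk (K : Type*) [Group K] [MulAction K X] : X → MulAction.orbitRel.Quotient K X :=
  Quotient.mk''

/-- The quotient map identifies `k • x` with `x`. -/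
theorem mk_smul (k : K) (x : X) : mk K (k • x) = mk K x :=
  Quotient.sound' (MulAction.orbitRel_apply.2 (MulAction.mem_orbit x k))

variable [MeasurableSpace X] (μ : Measure X)

/-- The quotient map is measurable (the quotient σ-algebra is the largest for which it is). -/
theorem measurable_mk : Measurable (mk K : X → MulAction.orbitRel.Quotient K X) :=
  measurable_quotient_mk''

/-- The push-forward measure `mk_*μ` on `X/K`. -/
noncomputable abbrev quotMeasure : Measure (MulAction.orbitRel.Quotient K X) :=
  μ.map (mk K)

/-- The quotient map is measure preserving from `μ` to `mk_*μ`. -/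
theorem measurePreserving_mk : MeasurePreserving (mk K) μ (quotMeasure (K := K) μ) :=
  (measurable_mk (K := K) (X := X)).measurePreserving μ

/-! ### The pull-back `L²(X/K) → L²(X)` -/

/-- The pull-back `h ↦ h ∘ mk` from `L²(X/K, mk_*μ)` to `L²(X, μ)`, a linear isometry. -/
noncomputable def pullback : Lp ℂ 2 (quotMeasure (K := K) μ) →ₗᵢ[ℂ] Lp ℂ 2 μ :=
  Lp.compMeasurePreservingₗᵢ ℂ (mk K) (measurePreserving_mk μ)

/-- Almost everywhere, `pullback μ h = h ∘ mk`. -/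
theorem coeFn_pullback (h : Lp ℂ 2 (quotMeasure (K := K) μ)) :
    pullback μ h =ᵐ[μ] h ∘ mk K :=
  Lp.coeFn_compMeasurePreserving h _

/-- The pull-back on `toLp` classes. -/
theorem pullback_toLp {h : MulAction.orbitRel.Quotient K X → ℂ}
    (hh : MemLp h 2 (quotMeasure (K := K) μ)) :
    pullback μ (hh.toLp h) = (hh.comp_measurePreserving (measurePreserving_mk μ)).toLp _ :=
  Lp.toLp_compMeasurePreserving hh _

/-- The pull-back preserves the `L²`-norm. -/
theorem norm_pullback (h : Lp ℂ 2 (quotMeasure (K := K) μ)) : ‖pullback μ h‖ = ‖h‖ :=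
  (pullback μ).norm_map h

/-- The pull-back is injective. -/
theorem pullback_injective : Function.Injective (pullback (K := K) μ) :=
  (pullback μ).injective

/-- The range of the pull-back is closed in `L²(X, μ)`. -/
theorem isClosed_range_pullback : IsClosed (Set.range (pullback (K := K) μ)) :=
  (pullback μ).isometry.isClosedEmbedding.isClosed_range

/-! ### The range of the pull-back consists of `K`-invariant vectors («L^{K_f}») -/

section Invariants

variable [MeasurableConstSMul K X] [SMulInvariantMeasure K X μ]

/-- The `K`-invariant vectors of `L²(X, μ)` under row 36's regular representation
`regularRep μ k f = f ∘ (k⁻¹ • ·)`: the prose's `L^{K_f}`. -/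
def invariants : Submodule ℂ (Lp ℂ 2 μ) where
  carrier := {f | ∀ k : K, regularRep μ k f = f}
  add_mem' := fun {f g} hf hg k => by rw [map_add, hf k, hg k]
  zero_mem' := fun k => map_zero _
  smul_mem' := fun c {f} hf k => by rw [map_smul, hf k]

/-- Membership in `invariants μ`. -/
theorem mem_invariants_iff {f : Lp ℂ 2 μ} :
    f ∈ invariants (K := K) μ ↔ ∀ k : K, regularRep μ k f = f :=
  Iff.rfl

/-- A pulled-back function is `K`-invariant: `(h ∘ mk) ∘ (k⁻¹ • ·) = h ∘ mk`. -/
theorem pullback_mem_invariants (h : Lp ℂ 2 (quotMeasure (K := K) μ)) :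
    pullback μ h ∈ invariants (K := K) μ := by
  intro k
  apply Lp.ext
  have h1 := coeFn_regularRep_apply μ k (pullback μ h)
  have h2 : (pullback μ h : X → ℂ) ∘ (fun x => k⁻¹ • x) =ᵐ[μ] (h ∘ mk K) ∘ (fun x => k⁻¹ • x) :=
    (measurePreserving_smul k⁻¹ μ).quasiMeasurePreserving.ae_eq_comp (coeFn_pullback μ h)
  have h3 : (h ∘ mk K) ∘ (fun x => k⁻¹ • x) = h ∘ mk K := by
    funext x
    simp only [Function.comp_apply, mk_smul]
  refine h1.trans (h2.trans ?_)
  rw [h3]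
  exact (coeFn_pullback μ h).symm

/-- The range of the pull-back lies in the `K`-invariants. -/
theorem range_pullback_le_invariants :
    LinearMap.range (pullback (K := K) μ).toLinearMap ≤ invariants (K := K) μ := by
  rintro f ⟨h, rfl⟩
  exact pullback_mem_invariants μ h

end Invariants

end Summit.Ventures.HodgeRepro2.T5QuotientPullback
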